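import Literature.MathematicalPhysics.QuantumFieldTheory.Balaban1983to89.B9Eq326G1kDivergenceRowClosed
import Literature.MathematicalPhysics.QuantumFieldTheory.Balaban1983to89.Beta.RemainderHasMajQkTower

/-!
# T. Bałaban, *Propagators for lattice gauge theories in a background field*, Commun. Math. Phys. **99** (1985) 389–434
# [Balaban1985BackgroundPropagators] Thm 3.3 (3.42) pp. 397–399 (the covariant-derivative line) with [Balaban1985Variational] (129) p. 297
# (*«(3.133) [5] with the additional inequality for the covariant Laplace operator»*), (190) p. 308: **THE DIVERGENCE LINE's `hEG0` LETTER OF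
# ROW (D4)'s NODE D ON NE9's TOWER — the NE9 crew's (DGK) `B9Eq326G1kDivergenceRowClosed.exists_divergence_row_G1k` (the sup row of `D*_U G₁,k(U)`
# on sites) AS `HasMaj S^{fine bonds}_m S^{fine sites}_m ((e_S ∘ D*_U∘G₁,k ∘ e⁻¹)↾ℝ) (B·e^{−δ·d_∞})`, `∃ (α₁, B, δ)` BEFORE THE HEIGHT**

CITATION HEADER (lean-in-tree rule 2026-08-18).  Sources: [Balaban1985BackgroundPropagators] (B9 = [5] of [15]; held `paper:balaban1985-cmp99-background-propagators`,
journal page = PDF page + 388): Thm 3.1 (3.42) p. 397 (the lines of (3.42): value, covariant derivative `∇_U`, covariant Laplacian `Δ_U`, Hölder quotient — the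
display's OCR in the held text layer is degraded; shape as described in the headers of (K64) ∕ (DGK)), Thm 3.3 p. 399 (*«the operator G(U) (a = 1) satisfies
the inequalities (3.42)–(3.47), with G′(U) replaced by G(U) and λ replaced by a function J defined at bonds»*), (3.8) p. 392 (the covariant divergence `D*_U`),
(3.26) p. 395, Thm 3.11 p. 416; [Balaban1985Variational] (B11 = [15]; `paper:balaban1985-cmp102-variational-background`, journal page = PDF page + 276): p. 297
after (128)–(129) (*«… and satisfies the bound (3.133) [5] with the additional inequality for the covariant Laplace operator»*), (182) p. 307, (190) p. 308;
[Balaban1984PropagatorsII] (B6) (2.51)–(2.52) p. 232.  [15] pp. 297, 306–308 and [5] pp. 397–399 re-read this generation in the held text layers; (3.8) as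
quoted in `B11Eq103H1Complex`'s header.

WHY THIS FILE (audit cell `pub-balaban`, BINDER row (D4), OWNER lineage `b2b-balaban-beta-an4`, gen 111; the recipe `HOME/b2b-balaban-beta-an4/g111/Y6-RECIPE.md`
and the probe `ProbeHEG0DivShape` a6f1c1b540b53814).  NODE D's (190) runs over every LINE of (3.42) ∕ (190) (`Data190.h190 : ∀ n i, …` over the (4.4) sizes
`i`).  «V81» `Beta.RemainderOriginLeftEntry.ineq190_origin_leftEntry_of_two_letters` assembles any left entry `E∘(H₀ + G̃Δ⁽²⁾H₀)` from V79's letters plus ONE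
letter `hEG0 : HasMaj b3 bE (E∘G₀) (B_E e^{−δ₁d})`.  For the DIVERGENCE line on NE9's tower, `E := D*_U = B11Eq103H1Complex.covDivL2K ℂ c₀ (η⁻¹)
(adTransportW φ (U⁻¹))` (fine bonds → fine sites), the NE9 crew's END (DGK) `B9Eq326G1kDivergenceRowClosed.exists_divergence_row_G1k` (ne9-leaf-03 g79: the
Woodbury assembly (DGL) `B9Eq326G1PostcompRowOfLetters` with the divergence row of the tower local part (DVTD) and the OWNER's (GRC)) proves the pointwise row
`‖(D*_U G₁,k f)(y)‖ ≤ B·e^{−δ·d_m(Π y, v)}·F` for `f` supported over the big block `Π⁻¹(v)` of the fine bonds, `∃ (α₁, B, δ)` BEFORE the height.  THIS FILE is the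
junction, token for token — «Y4b»'s two-carrier lemma `Beta.RemainderHasMajQkTower.hasMaj_supSize_of_local₂` at `X := Bond d (towerP L m (n+1))` (blocked by
`Π ∘ bpos`), `X′ := TSite d (towerP L m (n+1))` (blocked by `Π = blockCoord (L^(n+1)) m ∘ siteCast`).
* **`exists_hasMaj_divG1k_tower_sup`** — `∃ α₁ B δ, 0 < α₁ ∧ 0 ≤ B ∧ 0 < δ ∧ ∀ ⟨(DGK)'s block = (K64)'s⟩ (η₀ L₀ M₀ R) (H),
  HasMaj S^{fine bonds}_m S^{fine sites}_m ((e_S ∘ (D*_U ∘ G1k … hpos) ∘ e⁻¹)↾ℝ) (fun y v ↦ B·e^{−δ·tdist m (toSite y) (toSite v)})` — EXACTLY the `hEG0` binder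
  of «V81»'s tower instance for `E = D*_U` (to be typed: «Y5b»'s pattern with the left entry).

HONEST SCOPE.  [folklore] ONE application of the two-carrier socket lemma to the NE9 END, nothing restated; NO estimate of [5] is proved here; the constants are
the NE9 crew's (crude, height-free), NOT print's; the statement is about the cell's MODEL (the binders under the `∀`: window on bonds, plaquettes, bond gradients;
level averages `U1`-valued with display `αU` in the summable regime; contractive transporters; positivity `hpos′` ∕ `hpos` DISPLAYED) — «NE9 ⇐ the named
binders» travels with it; nothing identifies Bałaban's step-`k` objects with tree terms (NODE O FROZEN (0)).  Row (D4) class UNCHANGED (instance 0∕1; D4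
DISCHARGE NO DATE); NOT B12 Thm 2, NOT BetaPertH, NOT continuum, NOT Clay.  HONEST DEPENDENCY (cell line): continuum YM on T⁴ ⇐ BetaPertH ∧ nine spine
estimates (0/9 proved); BetaPertH ⇐ (D1) ∧ (D4) ∧ CAP+tail; G-an2-4 gates asym, D1 and NE2/3/4.  NEW file importing (DGK) and «Y4b»; nothing modified; 0
`def`; standard axioms; no `sorry`.  Net new unproved facts: 0.
-/

noncomputable section

open scoped BigOperators InnerProductSpace ComplexConjugate

namespace Literature.MathematicalPhysics.QuantumFieldTheory.Balaban1983to89.Beta.RemainderHasMajDivG1kTower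

open B11SectG B11SupSize190
open B4Sect5Torus (TSite tdist tdist_nonneg)
open B5TorusCover (UT)
open B9Thm34Ext (toB6)
open B9Thm37GlueTorus (torusGeom)
open B9SectCLatticeCarrier (Bond bpos unshift)
open B9Eq311L2Pairing (WL2)
open B9Eq319QprimeTorus (blockCoord)
open B9Eq315QTower (towerP UlevOf)
open B9Eq315QTorus (perCfg cornerSite)
open B9Eq316TowerFlatIsOneStep (siteCast towerP_eq_fineP_pow)
open B7Prop1Explicit (U1 Wcx boxVec)
open B9Eq310DeltaPrime (plaqHolU)
open B9Eq310HessianOperator (adTransportW)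
open B11Eq103H1Complex (SiteL2K BondL2K covDivL2K)
open B9Eq326OperatorTower (laplaceAk G1k)
open B9Eq324DeltaPrimeATower (laplacePrimeAk)
open B9Eq326G1kDivergenceRowClosed (exists_divergence_row_G1k)
open Beta.RemainderHasMajQkTower (hasMaj_supSize_of_local₂)

/-! ### Torus bookkeeping (private) -/

section Aux

variable {d : ℕ} {m : Fin d → ℕ}

/-- `ofSite a = y ↔ a = toSite y`. [folklore] -/
private theorem ofSite_eq_iff (a : TSite d m) (y : UT m) : UT.ofSite m a = y ↔ a = UT.toSite m y := by
  constructor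
  · rintro rfl; rfl
  · rintro rfl; rfl

/-- The boxes of the fine-bond big-block map are its fibres. [folklore] -/
private theorem mem_boxFine_iff {L : ℕ} [NeZero L] {n : ℕ} (y : UT m) (b : Bond d (towerP L m (n + 1))) :
    b ∈ (Finset.univ.filter fun b : Bond d (towerP L m (n + 1)) =>
        blockCoord (L ^ (n + 1)) m (siteCast (towerP_eq_fineP_pow L m (n + 1)) (bpos b)) = UT.toSite m y) ↔
      UT.ofSite m (blockCoord (L ^ (n + 1)) m (siteCast (towerP_eq_fineP_pow L m (n + 1)) (bpos b))) = y := by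
  rw [Finset.mem_filter, ofSite_eq_iff]
  simp

/-- The boxes of the fine-site big-block map are its fibres. [folklore] -/
private theorem mem_boxSite_iff {L : ℕ} [NeZero L] {n : ℕ} (y : UT m) (x : TSite d (towerP L m (n + 1))) :
    x ∈ (Finset.univ.filter fun x : TSite d (towerP L m (n + 1)) =>
        blockCoord (L ^ (n + 1)) m (siteCast (towerP_eq_fineP_pow L m (n + 1)) x) = UT.toSite m y) ↔
      UT.ofSite m (blockCoord (L ^ (n + 1)) m (siteCast (towerP_eq_fineP_pow L m (n + 1)) x)) = y := by
  rw [Finset.mem_filter, ofSite_eq_iff]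
  simp

end Aux

/-! ## The divergence line's `hEG0` letter on NE9's tower: (DGK) in the (190) sup currency, `∃ (α₁, B, δ)` first -/

section Tower

variable {d : ℕ} (hd : 1 ≤ d) (L : ℕ) [NeZero L] (hL : 1 ≤ L) (hL3 : 3 ≤ L)
  {𝔸 : Type*} [NormedRing 𝔸] [NormedAlgebra ℂ 𝔸] [CompleteSpace 𝔸] [NormOneClass 𝔸] [StarRing 𝔸] [NormedStarGroup 𝔸] [StarModule ℂ 𝔸]
  {W : Type} [NormedAddCommGroup W] [InnerProductSpace ℂ W] [FiniteDimensional ℂ W] (φ : W ≃ₗ[ℂ] 𝔸)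
  {Mφ Mφ' : ℝ} (hMφ : 0 ≤ Mφ) (hMφ' : 0 ≤ Mφ') (hφ : ∀ w, ‖φ w‖ ≤ Mφ * ‖w‖) (hφ' : ∀ X, ‖φ.symm X‖ ≤ Mφ' * ‖X‖) (hstar : ∀ X : 𝔸, ‖star X‖ ≤ ‖X‖)
  {a : ℝ} (ha : 0 < a) {a' : ℝ} (ha' : 0 < a') {ϱ : ℝ} (hϱ0 : 0 ≤ ϱ) (hϱ1 : ϱ < 1)
  (τ : 𝔸 →ₗ[ℂ] ℂ) {Cτ : ℝ} (hτ : ∀ X, ‖τ X‖ ≤ Cτ * ‖X‖) (hCτ : 0 ≤ Cτ) {Mτ : ℝ} (hτm : ∀ X Y : 𝔸, ‖τ (X * Y)‖ ≤ Mτ * ‖X‖ * ‖Y‖) (hMτ : 0 ≤ Mτ)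
  {ρw : ℝ} (hρw : 0 ≤ ρw)
  (hτ₁ : ∀ X : 𝔸, τ (star X) = conj (τ X)) (hτ₂ : ∀ X Y : 𝔸, τ (X * Y) = τ (Y * X)) (hφτ : ∀ X Y : 𝔸, ⟪φ.symm X, φ.symm Y⟫_ℂ = τ (star X * Y))
  (AQ : ℝ)

include hd hL hL3 hMφ hMφ' hφ hφ' hstar ha ha' hϱ0 hϱ1 hτ hCτ hτm hMτ hρw hτ₁ hτ₂ hφτ in
/-- **THE DIVERGENCE LINE's `hEG0` LETTER ON NE9's TOWER — (DGK) `exists_divergence_row_G1k` AS `HasMaj S^{fine bonds}_m S^{fine sites}_m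
((e_S ∘ D*_U∘G₁,k ∘ e⁻¹)↾ℝ) (B·e^{−δ·d_∞})`, `∃ (α₁, B, δ)` BEFORE THE HEIGHT** ([5] Thm 3.3: the covariant-derivative line of (3.42) for the bond
Green's function; [15] p. 297).  Binders = (DGK)'s (= (K64)'s), token for token, minus its source datum `(v, f, F)` and output site `y` (quantified inside
the majorant), plus an arbitrary torus geometry `(η₀, L₀, M₀, R, H)`; source = the fine bonds blocked by `Π ∘ bpos`, target = the fine sites blocked by
`Π = blockCoord (L^(n+1)) m ∘ siteCast`, both sup sizes of (190) over the torus of blocks `T_m`.  One application of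
`Beta.RemainderHasMajQkTower.hasMaj_supSize_of_local₂`; the operators `covDivL2K ℂ c₀ (η⁻¹) (adTransportW φ (U⁻¹))`, `G1k … hpos` and the constants are the NE9
crew's, untouched. [cite: Balaban1985BackgroundPropagators, Thm 3.1 (3.42) p.397, Thm 3.3 p.399, (3.8) p.392, (3.26) p.395, Thm 3.11 p.416]
[cite: Balaban1985Variational, p.297 after (128), (190) p.308] [cite: Balaban1984PropagatorsII, (2.51)–(2.52) p.232] -/
theorem exists_hasMaj_divG1k_tower_sup :
    ∃ α₁ B δ : ℝ, 0 < α₁ ∧ 0 ≤ B ∧ 0 < δ ∧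
      ∀ (n : ℕ) (η : ℝ) (_hηL : η * (L : ℝ) ^ (n + 1) = 1) (c₀ c₁ : ℝ) [Fact (0 < c₀)] [Fact (0 < c₁)]
        (_hw : c₀ * ((L : ℝ) ^ (n + 1)) ^ d = c₁) (_hρ : |η| ^ d / c₀ ≤ ρw) (m : Fin d → ℕ) [∀ i, NeZero (m i)] (_hm : ∀ i, 1 ≤ m i)
        (U : Bond d (towerP L m (n + 1)) → 𝔸ˣ) (αU : ℕ → ℝ) (_hα0 : ∀ j, 0 ≤ αU j) (hα1 : ∀ j, αU j ≤ 1 / 64)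
        (hU1 : ∀ (j : ℕ) (x : B7Prop1Explicit.Site d) (k : Fin d), perCfg (towerP L m (j + 1)) (UlevOf L m (n + 1) U j) x k ∈ U1 𝔸)
        (hreg : ∀ (j : ℕ) (y : TSite d (towerP L m j)) (k : Fin d) (ρ' : Fin d → Fin L),
          ‖((Wcx L (perCfg (towerP L m (j + 1)) (UlevOf L m (n + 1) U j)) (cornerSite L y) k (boxVec L ρ') : 𝔸ˣ) : 𝔸) - 1‖ ≤ αU j)
        (εU : ℕ → ℝ) (_hεU : ∀ j, 0 ≤ εU j) (_hUε : ∀ (j : ℕ) (b : Bond d (towerP L m (j + 1))), ‖(UlevOf L m (n + 1) U j b : 𝔸) - 1‖ ≤ εU j)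
        (_hLb : ∀ (j : ℕ) (b : Bond d (towerP L m (j + 1))), UlevOf L m (n + 1) U j b ∈ U1 𝔸)
        (α : ℝ) (_hα : 0 ≤ α) (_hαle : α ≤ α₁)
        (hUst : ∀ b, star (U b : 𝔸) = (((U b)⁻¹ : 𝔸ˣ) : 𝔸)) (_hUb : ∀ b, U b ∈ U1 𝔸) (_hUη : ∀ b, ‖(U b : 𝔸) - 1‖ ≤ α * η)
        (_hpl : ∀ p : B9SectCLatticeCarrier.Plaq d (towerP L m (n + 1)), ‖(plaqHolU U p : 𝔸) - 1‖ ≤ α * η ^ 2)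
        (_hUgrad : ∀ (x : TSite d (towerP L m (n + 1))) (μ : Fin d), ‖(U (x, μ) : 𝔸) - U (unshift μ x, μ)‖ ≤ α * η ^ 2)
        (_hRlev : ∀ (j : ℕ) (b : Bond d (towerP L m (j + 1))) (w : W), ‖adTransportW φ (UlevOf L m (n + 1) U j) b w‖ ≤ ‖w‖)
        (_hεg : ∀ j < n + 1, εU j ≤ α * ϱ ^ j) (_hAQ : ∑ j ∈ Finset.range (n + 1), αU j ≤ AQ)
        (hpos' : ∀ x : SiteL2K ℂ d (towerP L m (n + 1)) c₀ W, x ≠ 0 → 0 < RCLike.re ⟪x, laplacePrimeAk L m n φ η U a' (c₁ := c₁) x⟫_ℂ)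
        (hpos : ∀ x : BondL2K ℂ d (towerP L m (n + 1)) c₀ W, x ≠ 0 →
          0 < RCLike.re ⟪x, laplaceAk L m n φ η U hL αU hα1 hU1 hreg τ (c₀ := c₀) (c₁ := c₁) a x⟫_ℂ)
        (η₀ L₀ M₀ R : ℝ) (H : Prop),
        HasMaj
          (supSize (toB6 (torusGeom m η₀ L₀ M₀) R H)
            (fun y => Finset.univ.filter fun b : Bond d (towerP L m (n + 1)) =>
              blockCoord (L ^ (n + 1)) m (siteCast (towerP_eq_fineP_pow L m (n + 1)) (bpos b)) = UT.toSite m y)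
            (fun b => UT.ofSite m (blockCoord (L ^ (n + 1)) m (siteCast (towerP_eq_fineP_pow L m (n + 1)) (bpos b)))) :
              BlockNorm (toB6 (torusGeom m η₀ L₀ M₀) R H) (Bond d (towerP L m (n + 1)) → W))
          (supSize (toB6 (torusGeom m η₀ L₀ M₀) R H)
            (fun y => Finset.univ.filter fun x : TSite d (towerP L m (n + 1)) =>
              blockCoord (L ^ (n + 1)) m (siteCast (towerP_eq_fineP_pow L m (n + 1)) x) = UT.toSite m y)
            (fun x => UT.ofSite m (blockCoord (L ^ (n + 1)) m (siteCast (towerP_eq_fineP_pow L m (n + 1)) x))) :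
              BlockNorm (toB6 (torusGeom m η₀ L₀ M₀) R H) (TSite d (towerP L m (n + 1)) → W))
          (((WL2.linearEquiv ℂ ℂ (fun _ : TSite d (towerP L m (n + 1)) => c₀) :
                SiteL2K ℂ d (towerP L m (n + 1)) c₀ W ≃ₗ[ℂ] (TSite d (towerP L m (n + 1)) → W)).toLinearMap ∘ₗ
              (covDivL2K ℂ c₀ ((η : ℂ))⁻¹ (adTransportW φ fun bb => (U bb)⁻¹) ∘ₗ
                G1k L m n φ η U hL αU hα1 hU1 hreg τ (c₀ := c₀) (c₁ := c₁) hpos) ∘ₗ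
              (WL2.linearEquiv ℂ ℂ (fun _ : Bond d (towerP L m (n + 1)) => c₀) :
                BondL2K ℂ d (towerP L m (n + 1)) c₀ W ≃ₗ[ℂ] (Bond d (towerP L m (n + 1)) → W)).symm.toLinearMap).restrictScalars ℝ)
          (fun y v => B * Real.exp (-(δ * tdist m (UT.toSite m y) (UT.toSite m v)))) := by
  obtain ⟨α₁, B, δ, hα₁, hB, hδ, HK⟩ := exists_divergence_row_G1k hd L hL hL3 φ hMφ hMφ' hφ hφ' hstar ha ha' hϱ0 hϱ1 τ hτ hCτ hτm hMτ hρw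
    hτ₁ hτ₂ hφτ AQ
  refine ⟨α₁, B, δ, hα₁, hB, hδ, ?_⟩
  intro n η hηL c₀ c₁ _ _ hw hρ m _ hm U αU hα0 hα1 hU1 hreg εU hεU hUε hLb α hα hαle hUst hUb hUη hpl hUgrad hRlev hεg hAQ hpos' hpos η₀ L₀ M₀ R H
  refine hasMaj_supSize_of_local₂ (fun y b => mem_boxFine_iff y b) (fun y x => mem_boxSite_iff y x) _ (fun y v => by positivity) ?_
  intro v f F hfv hfF x
  -- the carrier element `e⁻¹ f`, whose values are those of `f`
  set f' : BondL2K ℂ d (towerP L m (n + 1)) c₀ W :=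
    (WL2.linearEquiv ℂ ℂ (fun _ : Bond d (towerP L m (n + 1)) => c₀) :
      BondL2K ℂ d (towerP L m (n + 1)) c₀ W ≃ₗ[ℂ] (Bond d (towerP L m (n + 1)) → W)).symm f with hf'
  have hfv' : ∀ b, blockCoord (L ^ (n + 1)) m (siteCast (towerP_eq_fineP_pow L m (n + 1)) (bpos b)) ≠ UT.toSite m v →
      WL2.equiv ℂ (fun _ : Bond d (towerP L m (n + 1)) => c₀) W f' b = 0 := by
    intro b hb
    have hne : UT.ofSite m (blockCoord (L ^ (n + 1)) m (siteCast (towerP_eq_fineP_pow L m (n + 1)) (bpos b))) ≠ v :=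
      fun h => hb ((ofSite_eq_iff _ _).1 h)
    exact hfv b hne
  have hfF' : ∀ b, ‖WL2.equiv ℂ (fun _ : Bond d (towerP L m (n + 1)) => c₀) W f' b‖ ≤ F := fun b => hfF b
  -- the value of the conjugated operator is that of `D*_U(G₁,k f′)`
  have hval : (((WL2.linearEquiv ℂ ℂ (fun _ : TSite d (towerP L m (n + 1)) => c₀) :
            SiteL2K ℂ d (towerP L m (n + 1)) c₀ W ≃ₗ[ℂ] (TSite d (towerP L m (n + 1)) → W)).toLinearMap ∘ₗ
          (covDivL2K ℂ c₀ ((η : ℂ))⁻¹ (adTransportW φ fun bb => (U bb)⁻¹) ∘ₗ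
            G1k L m n φ η U hL αU hα1 hU1 hreg τ (c₀ := c₀) (c₁ := c₁) hpos) ∘ₗ
          (WL2.linearEquiv ℂ ℂ (fun _ : Bond d (towerP L m (n + 1)) => c₀) :
            BondL2K ℂ d (towerP L m (n + 1)) c₀ W ≃ₗ[ℂ] (Bond d (towerP L m (n + 1)) → W)).symm.toLinearMap).restrictScalars ℝ) f x =
        WL2.equiv ℂ (fun _ : TSite d (towerP L m (n + 1)) => c₀) W
          (covDivL2K ℂ c₀ ((η : ℂ))⁻¹ (adTransportW φ fun bb => (U bb)⁻¹)
            (G1k L m n φ η U hL αU hα1 hU1 hreg τ (c₀ := c₀) (c₁ := c₁) hpos f')) x := rfl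
  rw [hval, UT.toSite_ofSite]
  exact HK n η hηL c₀ c₁ hw hρ m hm U αU hα0 hα1 hU1 hreg εU hεU hUε hLb α hα hαle hUst hUb hUη hpl hUgrad hRlev hεg hAQ hpos' hpos
    (UT.toSite m v) f' F hfv' hfF' x

end Tower

end Literature.MathematicalPhysics.QuantumFieldTheory.Balaban1983to89.Beta.RemainderHasMajDivG1kTower

end
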